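import Summits.Ventures.CertifiedArithmetic.LowPrec.Successor

/-!
# Rounding to odd in a minifloat format, and the parity of neighbours and midpoints

HONEST FRAMING (venture CertifiedArithmetic / cell `pub-lowprec`): certified error envelopes and
provably optimal rounding/accumulation schemes for low-precision formats under stated cost models;
every table by two implementations; no hardware or vendor claims.

ROUND TO ODD [BoldoMelquiond2008, §III; BoldoEtAl2023, §2.10.2]: `RO(t) = t` if `t` is a value
of the format, otherwise the one of the two values enclosing `t` whose integral significand is
ODD. `roundOdd φ x : MiniFloat φ` implements it on top of the cell's directed roundings
(`roundDown` / `roundUp`, `Directed.lean`), saturating like them at `±maxRat` and odd under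
negation by construction (`roundOddPos` on the magnitude, `flipSign` for negative inputs).

Proved here, for EVERY format with `m ≥ 1` trailing significand bits:
* `roundOddPos_eq_or` / `le_roundOddPos_of_le` / `roundOddPos_le_of_le`: `RO` is FAITHFUL
  (its value is `RD` or `RU`) and lies between any two values bracketing the input
  [BoldoMelquiond2008, Thm 2 (MinOrMax, Monotone)];
* `toRat_roundOddPos_of_exists`: exact on values; `toRat_roundOdd_neg`: symmetric
  [BoldoMelquiond2008, Thm 2 (SymmetricP)];
* `not_two_dvd_man_roundOddPos`: an INEXACT round-to-odd result has an odd trailing significand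
  (the defining property), via the parity alternation of consecutive values
  (`not_two_dvd_man_and_succ`: a nonnegative value and its successor `v + ulp(v)` are never both
  even — binade and subnormal/normal crossings included) and the intrinsic parity criterion
  `two_dvd_man_iff` (`man` even iff `2·ulp ∣ magnitude`);
* `two_dvd_man_of_toRat_eq_midpoint`: THE MIDPOINT OF TWO CONSECUTIVE NARROW VALUES IS EVEN IN
  THE WIDE FORMAT — for formats `φ`, `ψ` with `m_φ + 2 ≤ m_ψ` and `bias_φ ≤ bias_ψ`, every datum
  of `ψ` whose value is `v + ulp_φ(v)/2` (`v ≥ 0` a value of `φ`) has an even trailing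
  significand [BoldoMelquiond2008, Thm 3 "as k ≥ 2, the midpoint is even in the p+k precision"].
The double-rounding consequence (`RN_φ ∘ RO_ψ = RN_φ`) is `RoundToOddDouble.lean`.
-/

namespace Literature.ComputerArithmetic.FloatingPoint

/-! ### The rounding -/

/-- Round to odd of a rational `t` (used for `t ≥ 0`): `t` itself if it is a value, else the one
of `roundDown t`, `roundUp t` with odd trailing significand.
[cite: BoldoMelquiond2008, §III.A] -/
def roundOddPos (φ : Format) (t : ℚ) : MiniFloat φ :=
  if (roundDown φ t).toRat = t then roundDown φ t
  else if 2 ∣ (roundDown φ t).man then roundUp φ t else roundDown φ t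

/-- ROUND TO ODD into `φ` (saturating at `±top` beyond `±maxRat`, like the directed roundings it
is built from; odd under negation by construction). [cite: BoldoMelquiond2008, §III.A] -/
def roundOdd (φ : Format) (x : ℚ) : MiniFloat φ :=
  if x < 0 then (roundOddPos φ (-x)).flipSign else roundOddPos φ x

namespace MiniFloat

open Format

variable {φ ψ : Format}

/-! ### Parity of the trailing significand, intrinsically -/

/-- PARITY CRITERION: for `m ≥ 1` the trailing significand of a datum is even iff twice its ulp
(`ulp = 2^(expCode - 1)` quanta) divides its magnitude — uniformly for subnormal and normal data
(the implicit bit `2^m` is even). [folklore] -/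
theorem two_dvd_man_iff (hm : 1 ≤ φ.manBits) (z : MiniFloat φ) :
    2 ∣ z.man ↔ 2 * 2 ^ (z.expCode - 1) ∣ z.scaledMag := by
  unfold scaledMag Format.scaled
  split
  · rename_i h; rw [h]; simp
  · rw [show (2 ^ φ.manBits + z.man) * 2 ^ (z.expCode - 1)
          = 2 ^ (z.expCode - 1) * (2 ^ φ.manBits + z.man) from Nat.mul_comm _ _,
      show (2 : ℕ) * 2 ^ (z.expCode - 1) = 2 ^ (z.expCode - 1) * 2 from Nat.mul_comm _ _,
      Nat.mul_dvd_mul_iff_left (by positivity : 0 < 2 ^ (z.expCode - 1))]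
    exact (Nat.dvd_add_right (dvd_pow_self 2 (by omega))).symm

/-- From values to magnitudes: a nonnegative datum whose value is `n · quantum` has magnitude `n`.
[folklore] -/
theorem scaledMag_eq_of_toRat_eq {z : MiniFloat φ} {n : ℕ} (hz : z.toRat = (n : ℚ) * φ.quantum) :
    z.scaledMag = n := by
  have hq := φ.quantum_pos
  have hz0 : 0 ≤ z.toRat := by rw [hz]; positivity
  rw [toRat_eq_toInt_mul, toInt_eq_scaledMag_of_nonneg hz0] at hz
  have h := mul_right_cancel₀ hq.ne' hz
  exact_mod_cast h

/-- PARITY ALTERNATES ALONG THE VALUE GRID: a nonnegative value `d` and its successor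
`d + ulp(d)` never both have even trailing significands (if `d` is even its successor is odd) —
including the steps into the next binade and from the subnormal into the normal range.
[cite: BoldoMelquiond2008, §III.A] -/
theorem not_two_dvd_man_and_succ (hm : 1 ≤ φ.manBits) {d u : MiniFloat φ} (hd : 0 ≤ d.toRat)
    (hu : u.toRat = d.toRat + 2 ^ (d.expCode - 1) * φ.quantum) : ¬ (2 ∣ d.man ∧ 2 ∣ u.man) := by
  rintro ⟨h1, h2⟩
  rw [two_dvd_man_iff hm] at h1 h2
  have hS : u.scaledMag = d.scaledMag + 2 ^ (d.expCode - 1) := by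
    apply scaledMag_eq_of_toRat_eq
    rw [hu, toRat_eq_toInt_mul, toInt_eq_scaledMag_of_nonneg hd]; push_cast; ring
  have hle : d.scaledMag ≤ u.scaledMag := by rw [hS]; exact Nat.le_add_right _ _
  have he := ulpExp_mono hle
  have h3 : 2 * 2 ^ (d.expCode - 1) ∣ u.scaledMag :=
    dvd_trans (mul_dvd_mul_left 2 (Nat.pow_dvd_pow 2 he)) h2
  rw [hS] at h3
  have h4 : 2 * 2 ^ (d.expCode - 1) ∣ 2 ^ (d.expCode - 1) := (Nat.dvd_add_right h1).mp h3
  have h5 := Nat.le_of_dvd (by positivity) h4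
  have h6 := Nat.two_pow_pos (d.expCode - 1)
  omega

/-! ### Round to odd: faithful, exact on values, odd when inexact, symmetric -/

/-- `roundOddPos t` is `roundDown t` or `roundUp t` (faithfulness).
[cite: BoldoMelquiond2008, Thm 2] -/
theorem roundOddPos_eq_or (t : ℚ) :
    roundOddPos φ t = roundDown φ t ∨ roundOddPos φ t = roundUp φ t := by
  unfold roundOddPos; split_ifs <;> simp

/-- `roundDown` returns every in-range value unchanged. [folklore] -/
theorem toRat_roundDown_of_exists {t : ℚ} (ht : |t| ≤ φ.maxRat) (h : ∃ y : MiniFloat φ, y.toRat = t) :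
    (roundDown φ t).toRat = t := by
  obtain ⟨y, hy⟩ := h
  have h1 := toRat_roundDown_le ht
  have h2 := toRat_le_roundDown ht y hy.le
  linarith

/-- EXACT ON VALUES: `RO(t) = t` for every in-range value `t`. [cite: BoldoMelquiond2008, §III.A] -/
theorem toRat_roundOddPos_of_exists {t : ℚ} (ht : |t| ≤ φ.maxRat)
    (h : ∃ y : MiniFloat φ, y.toRat = t) : (roundOddPos φ t).toRat = t := by
  have h1 := toRat_roundDown_of_exists ht h
  unfold roundOddPos; rw [if_pos h1]; exact h1

/-- `RO(0) = 0`. [folklore] -/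
theorem toRat_roundOddPos_zero : (roundOddPos φ 0).toRat = 0 :=
  toRat_roundOddPos_of_exists (by rw [abs_zero]; exact mul_nonneg (Nat.cast_nonneg _) φ.quantum_pos.le)
    ⟨MiniFloat.zero φ, toRat_zero⟩

/-- `RD(t) ≤ RO(t) ≤ RU(t)` in range. [cite: BoldoMelquiond2008, Thm 2] -/
theorem roundDown_le_roundOddPos_le_roundUp {t : ℚ} (ht : |t| ≤ φ.maxRat) :
    (roundDown φ t).toRat ≤ (roundOddPos φ t).toRat ∧
      (roundOddPos φ t).toRat ≤ (roundUp φ t).toRat := by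
  have h1 := toRat_roundDown_le ht
  have h2 := le_toRat_roundUp ht
  rcases roundOddPos_eq_or (φ := φ) t with h | h <;> rw [h] <;> constructor <;> linarith

/-- Every value `≤ t` is `≤ RO(t)` (in range). [cite: BoldoMelquiond2008, Thm 2] -/
theorem le_roundOddPos_of_le {t : ℚ} (ht : |t| ≤ φ.maxRat) (y : MiniFloat φ) (hy : y.toRat ≤ t) :
    y.toRat ≤ (roundOddPos φ t).toRat :=
  le_trans (toRat_le_roundDown ht y hy) (roundDown_le_roundOddPos_le_roundUp ht).1

/-- Every value `≥ t` is `≥ RO(t)` (in range). [cite: BoldoMelquiond2008, Thm 2] -/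
theorem roundOddPos_le_of_le {t : ℚ} (ht : |t| ≤ φ.maxRat) (y : MiniFloat φ) (hy : t ≤ y.toRat) :
    (roundOddPos φ t).toRat ≤ y.toRat :=
  le_trans (roundDown_le_roundOddPos_le_roundUp ht).2 (roundUp_le_toRat ht y hy)

/-- THE DEFINING PROPERTY: an inexact round-to-odd result (`RO(t) ≠ t`, `0 < t < maxRat`, `m ≥ 1`)
has an ODD trailing significand. [cite: BoldoMelquiond2008, §III.A] -/
theorem not_two_dvd_man_roundOddPos (hm : 1 ≤ φ.manBits) {t : ℚ} (ht0 : 0 < t) (ht1 : t < φ.maxRat)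
    (hne : (roundOddPos φ t).toRat ≠ t) : ¬ 2 ∣ (roundOddPos φ t).man := by
  have habs : |t| ≤ φ.maxRat := by rw [abs_of_pos ht0]; exact ht1.le
  have hnd : (roundDown φ t).toRat ≠ t := by
    intro h; apply hne; unfold roundOddPos; rw [if_pos h]; exact h
  unfold roundOddPos at hne ⊢
  rw [if_neg hnd] at hne ⊢
  by_cases hev : 2 ∣ (roundDown φ t).man
  · rw [if_pos hev] at hne ⊢
    have hnv : ¬ ∃ y : MiniFloat φ, y.toRat = t := fun h => hnd (toRat_roundDown_of_exists habs h)
    obtain ⟨hv0, hvs, hsu, ⟨u, hu⟩, hgap⟩ := roundDown_bracket ht0 ht1 hnv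
    have hru : (roundUp φ t).toRat
        = (roundDown φ t).toRat + 2 ^ ((roundDown φ t).expCode - 1) * φ.quantum := by
      have h1 : t ≤ (roundUp φ t).toRat := le_toRat_roundUp habs
      have h2 : (roundUp φ t).toRat ≤ u.toRat := roundUp_le_toRat habs u (by rw [hu]; exact hsu.le)
      rcases hgap (roundUp φ t) with h | h
      · exfalso; linarith
      · rw [hu] at h2; exact le_antisymm h2 h
    intro h2u
    exact not_two_dvd_man_and_succ hm hv0 hru ⟨hev, h2u⟩
  · rw [if_neg hev] at hne ⊢; exact hev

/-- For `x ≥ 0`, `roundOdd x = roundOddPos x`. [folklore] -/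
theorem roundOdd_of_nonneg {x : ℚ} (hx : 0 ≤ x) : roundOdd φ x = roundOddPos φ x := by
  unfold roundOdd; rw [if_neg (not_lt.mpr hx)]

/-- SYMMETRY: `RO(-x) = -RO(x)` as values. [cite: BoldoMelquiond2008, Thm 2] -/
theorem toRat_roundOdd_neg (x : ℚ) : (roundOdd φ (-x)).toRat = -(roundOdd φ x).toRat := by
  unfold roundOdd
  rcases lt_trichotomy x 0 with h | rfl | h
  · rw [if_neg (by linarith : ¬ -x < 0), if_pos h, toRat_flipSign, neg_neg]
  · simp only [neg_zero, lt_self_iff_false, if_false, toRat_roundOddPos_zero]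
  · rw [if_pos (by linarith : -x < 0), if_neg (by linarith : ¬ x < 0), toRat_flipSign, neg_neg]

/-! ### Narrow midpoints are even in a format with two more significand bits -/

/-- THE MIDPOINT IS EVEN IN THE WIDE FORMAT: for `m_φ + 2 ≤ m_ψ`, `bias_φ ≤ bias_ψ`, a nonnegative
value `v` of `φ` with ulp `G = 2^(expCode v - 1)·quantum_φ`, and ANY datum `z` of `ψ` with value
`v + G/2`: the trailing significand of `z` is even. (`v + G/2 = (2c+1)·2^(e+t+1)` quanta of `ψ`
with `2c+1 < 2^(m_φ+2) ≤ 2^(m_ψ)` and `t ≥ 0`: an odd `ψ`-significand would have to be `2c+1`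
itself, too short to be normal and on too coarse a grid to be subnormal.)
[cite: BoldoMelquiond2008, Thm 3] -/
theorem two_dvd_man_of_toRat_eq_midpoint (hm : φ.manBits + 2 ≤ ψ.manBits) (hb : φ.bias ≤ ψ.bias)
    {v : MiniFloat φ} (hv : 0 ≤ v.toRat) (z : MiniFloat ψ)
    (hz : z.toRat = v.toRat + 2 ^ (v.expCode - 1) * φ.quantum / 2) : 2 ∣ z.man := by
  have hqφ := φ.quantum_pos
  have hqψ := ψ.quantum_pos
  obtain ⟨t, ht⟩ : ∃ t, (ψ.manBits - φ.manBits) + (ψ.bias - φ.bias) = t + 2 :=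
    ⟨(ψ.manBits - φ.manBits) + (ψ.bias - φ.bias) - 2, by omega⟩
  have hquant : φ.quantum = 2 * 2 ^ (t + 1) * ψ.quantum := by
    rw [quantum_eq_pow_mul_quantum (by omega) hb, ht, pow_succ, pow_succ]; ring
  set e := v.expCode - 1 with he_def
  obtain ⟨c, hc⟩ := pow_ulpExp_dvd_scaledMag v
  have hclt : c < 2 ^ (φ.manBits + 1) := by
    have h1 := scaledMag_lt_pow_ulpExp v
    rw [hc, pow_add, mul_comm (2 ^ (φ.manBits + 1)) _] at h1
    exact Nat.lt_of_mul_lt_mul_left h1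
  -- the magnitude of `z` in `ψ`-quanta
  have hS : z.scaledMag = (2 * c + 1) * 2 ^ (e + (t + 1)) := by
    apply scaledMag_eq_of_toRat_eq
    rw [hz, toRat_eq_toInt_mul, toInt_eq_scaledMag_of_nonneg hv, hc, hquant]
    push_cast; ring
  have hmψ : 1 ≤ ψ.manBits := by omega
  rw [two_dvd_man_iff hmψ z, hS]
  have hdvd : 2 ^ (z.expCode - 1) ∣ (2 * c + 1) * 2 ^ (e + (t + 1)) := by
    rw [← hS]; exact pow_ulpExp_dvd_scaledMag z
  have hle : z.expCode - 1 ≤ e + (t + 1) := by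
    by_contra hgt
    have h1 : 2 ^ (e + (t + 1) + 1) ∣ (2 * c + 1) * 2 ^ (e + (t + 1)) :=
      dvd_trans (Nat.pow_dvd_pow 2 (by omega)) hdvd
    rw [pow_succ, Nat.mul_comm (2 ^ (e + (t + 1))) 2,
      Nat.mul_dvd_mul_iff_right (Nat.two_pow_pos _)] at h1
    omega
  rcases Nat.lt_or_ge (z.expCode - 1) (e + (t + 1)) with hlt | hge
  · have h2 : 2 * 2 ^ (z.expCode - 1) ∣ 2 ^ (e + (t + 1)) := by
      rw [← pow_succ']; exact Nat.pow_dvd_pow 2 (by omega)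
    exact dvd_trans h2 (dvd_mul_left _ _)
  · exfalso
    have heq : z.expCode - 1 = e + (t + 1) := le_antisymm hle hge
    rcases Nat.eq_zero_or_pos z.expCode with h0 | hpos
    · rw [h0] at heq; omega
    · have hlow := pow_le_scaledMag_of_expCode_pos z hpos
      rw [hS, heq, pow_add] at hlow
      have h2 : 2 ^ ψ.manBits ≤ 2 * c + 1 := Nat.le_of_mul_le_mul_right hlow (by positivity)
      have h3 : 2 * c + 1 < 2 ^ (φ.manBits + 2) := by
        rw [pow_succ]; omega
      have h4 : 2 ^ (φ.manBits + 2) ≤ 2 ^ ψ.manBits := Nat.pow_le_pow_right (by norm_num) hm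
      omega

end MiniFloat

end Literature.ComputerArithmetic.FloatingPoint
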